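import Mathlib
import HarnessLib

/-!
# Series–parallel bond structures (route PrecisionLaplacian, crux `InverseMFerromagnet`, line `Sketch`)

A *bond structure* is what the crux quantifies over: `n` sites `Fin n`, `m` bonds `Fin m`, and the
support map `C : Fin m → Finset (Fin n)` (pair supports, repetitions = parallel bonds allowed; the
couplings `K : Fin m → ℝ` are quantified separately).  This file defines the inductive class
`IsSeriesParallel n m C` of SERIES–PARALLEL structures: the least class containing the bondless
structures and closed under

* appending a PENDANT site `Fin.last n` joined to an old site `v` by the new bond `Fin.last m`,
* appending a PARALLEL copy `Fin.last m` of an existing bond `i₀`,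
* SUBDIVIDING a bond `i₀ = {a, b}` through the new site `Fin.last n`
  (bond `i₀ ↦ {a, last}`, new bond `Fin.last m = {last, b}`),
* RELABELLING sites and bonds by permutations.

By the classical reduction theory of graphs of treewidth ≤ 2 (Duffin 1965; Arnborg–Proskurowski 1986:
a multigraph is K₄-minor-free iff it reduces to isolated vertices by deleting vertices of degree ≤ 1,
suppressing vertices of degree 2 and merging parallel edges) these are exactly the structures whose
underlying multigraph is series–parallel (K₄-minor-free), with any number of isolated sites.
The constructors are phrased by EQUATIONS on the new support map `C'` (rather than by an explicit
formula) so that they match the hypotheses of the landed induction steps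
`helper_sp_pendant/parallel/subdivide/relabel` (Theorems `…InverseMFerromagnetSp*.lean`) literally.

Used by: `helper_im_seriesParallel` (DB♯, hence the inverse-M property IM, for every series–parallel
zero-field pair ferromagnet — the first extension of Lauritzen–Uhler–Zwiernik 2021, Prop. 5.3 (cycles)
to an infinite minor-closed class).  Deliberately NOT here: any statement about couplings or
correlations (this file is combinatorics only), and no claim that the class is minor-closed (not needed).
-/

namespace Summit.CriticalPhenomena.Ising3DConformalLimit.Cruxes.InverseMFerromagnet.PartialCovarianceLadder

/-- **Series–parallel bond structures** (sites `Fin n`, bonds `Fin m`, supports `C`): the least class of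
structures containing every bondless structure (`m = 0`, any number of isolated sites) and closed under
appending a pendant site, appending a parallel bond, subdividing a bond through a new site, and
relabelling sites/bonds.  Equivalently (Duffin 1965, Arnborg–Proskurowski 1986) the structures whose
underlying multigraph has no `K₄` minor (treewidth ≤ 2). [folklore] -/
inductive IsSeriesParallel : (n m : ℕ) → (Fin m → Finset (Fin n)) → Prop
  /-- a structure without bonds (any number of isolated sites) is series–parallel -/
  | base (n : ℕ) (C : Fin 0 → Finset (Fin n)) : IsSeriesParallel n 0 C
  /-- append the pendant site `Fin.last n`, joined to the old site `v` by the new bond `Fin.last m` -/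
  | pendant {n m : ℕ} {C : Fin m → Finset (Fin n)} (h : IsSeriesParallel n m C) (v : Fin n)
      (C' : Fin (m + 1) → Finset (Fin (n + 1)))
      (hold : ∀ i : Fin m, C' i.castSucc = (C i).map Fin.castSuccEmb)
      (hnew : C' (Fin.last m) = {v.castSucc, Fin.last n}) :
      IsSeriesParallel (n + 1) (m + 1) C'
  /-- append a parallel copy `Fin.last m` of the bond `i₀` -/
  | parallel {n m : ℕ} {C : Fin m → Finset (Fin n)} (h : IsSeriesParallel n m C) (i₀ : Fin m)
      (C' : Fin (m + 1) → Finset (Fin n))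
      (hold : ∀ i : Fin m, C' i.castSucc = C i) (hnew : C' (Fin.last m) = C i₀) :
      IsSeriesParallel n (m + 1) C'
  /-- subdivide the bond `i₀ = {a, b}` through the new site `Fin.last n`:
  bond `i₀` becomes `{a, last}` and the new bond `Fin.last m` is `{last, b}` -/
  | subdivide {n m : ℕ} {C : Fin m → Finset (Fin n)} (h : IsSeriesParallel n m C) (i₀ : Fin m)
      (a b : Fin n) (hab : a ≠ b) (hi₀ : C i₀ = {a, b})
      (C' : Fin (m + 1) → Finset (Fin (n + 1)))
      (hold : ∀ i : Fin m, i ≠ i₀ → C' i.castSucc = (C i).map Fin.castSuccEmb)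
      (hi₀' : C' i₀.castSucc = {a.castSucc, Fin.last n})
      (hnew : C' (Fin.last m) = {Fin.last n, b.castSucc}) :
      IsSeriesParallel (n + 1) (m + 1) C'
  /-- relabel sites by `eV` and bonds by `eι` -/
  | relabel {n m : ℕ} {C : Fin m → Finset (Fin n)} (h : IsSeriesParallel n m C)
      (eV : Equiv.Perm (Fin n)) (eι : Equiv.Perm (Fin m)) (C' : Fin m → Finset (Fin n))
      (hC' : ∀ i, C' i = (C (eι i)).map eV.toEmbedding) :
      IsSeriesParallel n m C'

/-- Every bond of a series–parallel structure is a pair (`(C i).card = 2`): the class lives inside the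
crux's hypothesis `∀ i, (C i).card = 2`. [folklore] -/
theorem isSeriesParallel_card_eq_two :
    ∀ (n m : ℕ) (C : Fin m → Finset (Fin n)), IsSeriesParallel n m C → ∀ i, (C i).card = 2 := by
  intro n m C h
  induction h with
  | base n C => exact fun i => i.elim0
  | pendant h v C' hold hnew ih =>
      intro i
      refine Fin.lastCases ?_ (fun j => ?_) i
      · rw [hnew, Finset.card_pair]
        exact fun h' => (Fin.castSucc_lt_last v).ne h'
      · rw [hold j, Finset.card_map]
        exact ih j
  | parallel h i₀ C' hold hnew ih =>
      intro i
      refine Fin.lastCases ?_ (fun j => ?_) i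
      · rw [hnew]; exact ih i₀
      · rw [hold j]; exact ih j
  | subdivide h i₀ a b hab hi₀ C' hold hi₀' hnew ih =>
      intro i
      refine Fin.lastCases ?_ (fun j => ?_) i
      · rw [hnew, Finset.card_pair]
        exact fun h' => (Fin.castSucc_lt_last b).ne h'.symm
      · by_cases hj : j = i₀
        · subst hj
          rw [hi₀', Finset.card_pair]
          exact fun h' => (Fin.castSucc_lt_last a).ne h'
        · rw [hold j hj, Finset.card_map]
          exact ih j
  | relabel h eV eι C' hC' ih =>
      intro i
      rw [hC' i, Finset.card_map]
      exact ih (eι i)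

/-! ## Series–parallel EXTENSIONS of an arbitrary base class (lead c3, wave 5)

The four constructor steps of T-SP never use series–parallelness of the smaller structure, so DB♯ (for all
couplings) propagates from ANY base class of structures to its closure under pendant / parallel / subdivide /
relabel.  `IsSPClosure base` is that closure; `IsSeriesParallel = IsSPClosure (bondless)` morally, and with the base
"at most four sites" (where DB♯ is the landed `helper_db_le_four`) the closure contains every structure whose
reduction core has ≤ 4 sites — e.g. all subdivisions of `K₄` with pendant trees attached (treewidth 3). -/

/-- **Series–parallel closure of a base class of bond structures**: the least class containing every structure
satisfying `base` and closed under appending a pendant site, appending a parallel bond, subdividing a bond through a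
new site, and relabelling sites/bonds (same constructors, same equations on `C'`, as `IsSeriesParallel`). [folklore] -/
inductive IsSPClosure (base : (n m : ℕ) → (Fin m → Finset (Fin n)) → Prop) :
    (n m : ℕ) → (Fin m → Finset (Fin n)) → Prop
  /-- every base structure is in the closure -/
  | base {n m : ℕ} (C : Fin m → Finset (Fin n)) (h : base n m C) : IsSPClosure base n m C
  /-- append the pendant site `Fin.last n`, joined to the old site `v` by the new bond `Fin.last m` -/
  | pendant {n m : ℕ} {C : Fin m → Finset (Fin n)} (h : IsSPClosure base n m C) (v : Fin n)
      (C' : Fin (m + 1) → Finset (Fin (n + 1)))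
      (hold : ∀ i : Fin m, C' i.castSucc = (C i).map Fin.castSuccEmb)
      (hnew : C' (Fin.last m) = {v.castSucc, Fin.last n}) :
      IsSPClosure base (n + 1) (m + 1) C'
  /-- append a parallel copy `Fin.last m` of the bond `i₀` -/
  | parallel {n m : ℕ} {C : Fin m → Finset (Fin n)} (h : IsSPClosure base n m C) (i₀ : Fin m)
      (C' : Fin (m + 1) → Finset (Fin n))
      (hold : ∀ i : Fin m, C' i.castSucc = C i) (hnew : C' (Fin.last m) = C i₀) :
      IsSPClosure base n (m + 1) C'
  /-- subdivide the bond `i₀ = {a, b}` through the new site `Fin.last n` -/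
  | subdivide {n m : ℕ} {C : Fin m → Finset (Fin n)} (h : IsSPClosure base n m C) (i₀ : Fin m)
      (a b : Fin n) (hab : a ≠ b) (hi₀ : C i₀ = {a, b})
      (C' : Fin (m + 1) → Finset (Fin (n + 1)))
      (hold : ∀ i : Fin m, i ≠ i₀ → C' i.castSucc = (C i).map Fin.castSuccEmb)
      (hi₀' : C' i₀.castSucc = {a.castSucc, Fin.last n})
      (hnew : C' (Fin.last m) = {Fin.last n, b.castSucc}) :
      IsSPClosure base (n + 1) (m + 1) C'
  /-- relabel sites by `eV` and bonds by `eι` -/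
  | relabel {n m : ℕ} {C : Fin m → Finset (Fin n)} (h : IsSPClosure base n m C)
      (eV : Equiv.Perm (Fin n)) (eι : Equiv.Perm (Fin m)) (C' : Fin m → Finset (Fin n))
      (hC' : ∀ i, C' i = (C (eι i)).map eV.toEmbedding) :
      IsSPClosure base n m C'

/-- If every base structure has pair bonds, so does every structure in the closure. [folklore] -/
theorem isSPClosure_card_eq_two :
    ∀ (base : (n m : ℕ) → (Fin m → Finset (Fin n)) → Prop),
      (∀ n m C, base n m C → ∀ i, (C i).card = 2) →
      ∀ (n m : ℕ) (C : Fin m → Finset (Fin n)), IsSPClosure base n m C → ∀ i, (C i).card = 2 := by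
  intro base hbase n m C h
  induction h with
  | base C h => exact hbase _ _ C h
  | pendant h v C' hold hnew ih =>
      intro i
      refine Fin.lastCases ?_ (fun j => ?_) i
      · rw [hnew, Finset.card_pair]
        exact fun h' => (Fin.castSucc_lt_last v).ne h'
      · rw [hold j, Finset.card_map]
        exact ih j
  | parallel h i₀ C' hold hnew ih =>
      intro i
      refine Fin.lastCases ?_ (fun j => ?_) i
      · rw [hnew]; exact ih i₀
      · rw [hold j]; exact ih j
  | subdivide h i₀ a b hab hi₀ C' hold hi₀' hnew ih =>
      intro i
      refine Fin.lastCases ?_ (fun j => ?_) i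
      · rw [hnew, Finset.card_pair]
        exact fun h' => (Fin.castSucc_lt_last b).ne h'.symm
      · by_cases hj : j = i₀
        · subst hj
          rw [hi₀', Finset.card_pair]
          exact fun h' => (Fin.castSucc_lt_last a).ne h'
        · rw [hold j hj, Finset.card_map]
          exact ih j
  | relabel h eV eι C' hC' ih =>
      intro i
      rw [hC' i, Finset.card_map]
      exact ih (eι i)

/-- The series–parallel structures are the closure of the bondless ones. [folklore] -/
theorem isSPClosure_of_isSeriesParallel :
    ∀ (n m : ℕ) (C : Fin m → Finset (Fin n)), IsSeriesParallel n m C →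
      IsSPClosure (fun _ m _ => m = 0) n m C := by
  intro n m C h
  induction h with
  | base n C => exact IsSPClosure.base C rfl
  | pendant h v C' hold hnew ih => exact IsSPClosure.pendant ih v C' hold hnew
  | parallel h i₀ C' hold hnew ih => exact IsSPClosure.parallel ih i₀ C' hold hnew
  | subdivide h i₀ a b hab hi₀ C' hold hi₀' hnew ih => exact IsSPClosure.subdivide ih i₀ a b hab hi₀ C' hold hi₀' hnew
  | relabel h eV eι C' hC' ih => exact IsSPClosure.relabel ih eV eι C' hC'

end Summit.CriticalPhenomena.Ising3DConformalLimit.Cruxes.InverseMFerromagnet.PartialCovarianceLadder
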